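import Summits.Ventures.PercRepro.ProfileTwoDeletion

/-!
# PercRepro — `INDEP_{2,u}` ON EVERY SIMPLE MATROID: THE AVERAGED DELETION STEP
(p10, gen 4; S5 §2.5 of `proofs/SUBCLAIM-S5-p10.md`; one-pager `proofs/P10-AVGSTEP.md`)

`INDEP_{2,u}(M)` is `Σ_{B independent pair} demand(B) ≤ C(u,2) · #{independent u-sets}` with
`demand(B) = [u ≤ ρ(E∖B)] · C(ρ(E∖B), u−2)` (`Indep2`, ProfileTwoDeletion).  On every simple matroid it is the
row `q = 2` of the profile inequality, by the bridge `profileIneq_two_of_indep`.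

This file proves `INDEP_{2,u}` on EVERY simple matroid, for every `u ≥ 3`, by a strong induction on `|E|` in
which the deletions `M ∖ z` are AVERAGED over all `z ∈ E` instead of chosen:

* `Σ_{z ∈ E} I_u(M ∖ z) = (|E| − u) · I_u(M)` (every independent `u`-set is avoided by `|E| − u` elements;
  `sum_card_indepSets_delete_add`), so the induction hypothesis on the simple matroids `M ∖ z` pays
  `C(u,2) · (|E| − u) · I_u(M) ≥ Σ_z D₂(M ∖ z; u)`;
* **the per-pair inequality** `(|E| − u) · demand_M(B) ≤ Σ_{z ∈ E ∖ B} demand_{M ∖ z}(B)` (`perPair`), which holds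
  TERMWISE: with `X := E ∖ B`, `ρ := ρ(X)` and `κ := #coloops(M|X)`, the right side is
  `(|X| − κ) · d(ρ) + κ · d(ρ − 1)` (`sum_ite_erase`), and `κ ≤ ρ` (`card_coloops_le_rk`) settles the levels
  `ρ ≥ u + 1` while `κ ≤ u − 2` at `ρ = u` (`card_coloops_le_of_rk_eq`: a rank-`u` set with `≥ u + 1` elements
  of a simple matroid has at most `u − 2` coloops) settles the level `ρ = u`;
* summing over the pairs and swapping the sums (`avg_step`) gives `(|E| − u) · D₂(M; u) ≤ Σ_z D₂(M ∖ z; u)`,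
  and the levels `|E| ≤ u + 2` are the degenerate cases of ProfileTwoDeletion.

No choice of a deletion element, no contraction and no case analysis on cocircuits is needed; the single-`z`
step `STEP′(z)` of ProfileTwoDeletion is not used.  The inequality `avg_step` is verified exactly on every simple
matroid on `≤ 9` elements (0 failures at every level with `|E| − u ≥ 3`; `mining/p10/g4/`).

* `demand_eq_ite`, `demand_delete_eq_ite`, `sum_ite_erase` — the demand `[u ≤ r] · C(r, u−2)` as a function of
  the rank of the complement, in `M` and in `M ∖ z`;
* `sum_card_indepSetsThrough`, `sum_card_indepSets_delete_add` — the deletion average of the independent `u`-sets;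
* `rk_erase_of_mem_coloops`, `rk_erase_of_notMem_coloops`, `card_coloops_le_rk`, `card_coloops_le_of_rk_eq` —
  coloops of a restriction;
* `perPair_arith_core`, `perPair_arith`, `perPair` — the per-pair inequality;
* `avg_step` — the averaged deletion step;
* **`indep2_of_simple`** — `INDEP_{2,u}` on every simple matroid, every `u ≥ 3`; `indep2_two` — the level `u = 2`.
-/

open scoped Matroid

namespace PercRepro.Cogirth

open Finset ThmH Skew Shadow Profile

variable {α : Type} [DecidableEq α] {M : Matroid α} [M.Finite]

/-! ### The deletion average of the independent `u`-sets -/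

/-- `Σ_{z ∈ E} #{S ∈ I_u(M) : z ∈ S} = u · I_u(M)`: every independent `u`-set is counted once per element. -/
theorem sum_card_indepSetsThrough (u : ℕ) :
    ∑ z ∈ gr M, (indepSetsThrough M u z).card = u * (indepSets M u).card := by
  unfold indepSetsThrough
  have h : ∀ (z : α) (S : Finset α), z ∈ gr M ∧ S ∈ (indepSets M u).filter (fun S => z ∈ S) ↔
      z ∈ S ∧ S ∈ indepSets M u := by
    intro z S
    rw [mem_filter]
    constructor
    · rintro ⟨_, hS, hz⟩
      exact ⟨hz, hS⟩
    · rintro ⟨hz, hS⟩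
      exact ⟨(mem_indepSets.1 hS).1 hz, hS, hz⟩
  calc ∑ z ∈ gr M, ((indepSets M u).filter (fun S => z ∈ S)).card
      = ∑ z ∈ gr M, ∑ S ∈ (indepSets M u).filter (fun S => z ∈ S), 1 := by
        simp only [card_eq_sum_ones]
    _ = ∑ S ∈ indepSets M u, ∑ z ∈ S, 1 := sum_comm' h
    _ = ∑ S ∈ indepSets M u, u := by
        apply sum_congr rfl
        intro S hS
        rw [← card_eq_sum_ones, (mem_indepSets.1 hS).2.1]
    _ = u * (indepSets M u).card := by rw [sum_const, smul_eq_mul, mul_comm]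

/-- `Σ_{z ∈ E} I_u(M ∖ z) + u · I_u(M) = |E| · I_u(M)`: the deletion average of the independent `u`-sets. -/
theorem sum_card_indepSets_delete_add (u : ℕ) :
    ∑ z ∈ gr M, (indepSets (M ＼ ({z} : Set α)) u).card + u * (indepSets M u).card =
      (gr M).card * (indepSets M u).card := by
  calc ∑ z ∈ gr M, (indepSets (M ＼ ({z} : Set α)) u).card + u * (indepSets M u).card
      = ∑ z ∈ gr M, ((indepSets (M ＼ ({z} : Set α)) u).card + (indepSetsThrough M u z).card) := by
        rw [sum_add_distrib, sum_card_indepSetsThrough]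
    _ = ∑ z ∈ gr M, (indepSets M u).card := by
        apply sum_congr rfl
        intro z _
        exact (card_indepSets_eq_delete_add_through z u).symm
    _ = (gr M).card * (indepSets M u).card := by rw [sum_const, smul_eq_mul]

/-! ### The demand as a function of the rank of the complement
(`[u ≤ r] · C(r, u−2)`, written `if u ≤ r then r.choose (u - 2) else 0` throughout) -/

/-- `demand M 2 u B = [u ≤ ρ(E ∖ B)] · C(ρ(E ∖ B), u − 2)`. -/
theorem demand_eq_ite (u : ℕ) (B : Finset α) :
    demand M 2 u B = if u ≤ rk M (gr M \ B) then (rk M (gr M \ B)).choose (u - 2) else 0 := rfl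

/-- The demand of a pair `B` in `M ∖ z` is read off the rank of `(E ∖ B) ∖ z` in `M`. -/
theorem demand_delete_eq_ite (u : ℕ) (B : Finset α) (z : α) :
    demand (M ＼ ({z} : Set α)) 2 u B =
      if u ≤ rk M ((gr M \ B).erase z) then (rk M ((gr M \ B).erase z)).choose (u - 2) else 0 := by
  unfold demand
  have hsub : (gr M \ B).erase z ⊆ (gr M).erase z := erase_subset_erase z sdiff_subset
  rw [gr_delete', erase_sdiff, rk_delete hsub]

/-! ### Coloops of a restriction -/

/-- Removing a coloop of `X` drops the rank by one (natural-number form). -/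
theorem rk_erase_of_mem_coloops {X : Finset α} (hX : X ⊆ gr M) {z : α} (hz : z ∈ coloops M X) :
    rk M (X.erase z) + 1 = rk M X := by
  have h := eRk_erase_add_one_of_mem_coloops hX hz
  rw [← coe_rk, ← coe_rk] at h
  exact_mod_cast h

/-- Removing a non-coloop of `X` keeps the rank. -/
theorem rk_erase_of_notMem_coloops {X : Finset α} (hX : X ⊆ gr M) {z : α} (hzX : z ∈ X)
    (hz : z ∉ coloops M X) : rk M (X.erase z) = rk M X := by
  simp only [mem_coloops, not_and, not_not] at hz
  have hcl := hz hzX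
  have h := rk_insert_eq (M := M) (hX hzX) (X := X.erase z) ((erase_subset z X).trans hX)
  rw [insert_erase hzX, if_pos hcl] at h
  exact h.symm

/-- The coloops of `X` are elements of `X`. -/
theorem coloops_subset (X : Finset α) : coloops M X ⊆ X := fun _ hz => (mem_coloops.1 hz).1

/-- `ρ(X ∖ coloops X) + #coloops X = ρ(X)`. -/
theorem rk_sdiff_coloops_add_card {X : Finset α} (hX : X ⊆ gr M) :
    rk M (X \ coloops M X) + (coloops M X).card = rk M X := by
  have h := eRk_sdiff_add_card_of_subset_coloops hX (coloops M X) subset_rfl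
  rw [← coe_rk, ← coe_rk] at h
  exact_mod_cast h

/-- A set has at most `ρ(X)` coloops. -/
theorem card_coloops_le_rk {X : Finset α} (hX : X ⊆ gr M) : (coloops M X).card ≤ rk M X := by
  have h := rk_sdiff_coloops_add_card (M := M) hX
  omega

/-- In a simple matroid, a set of rank `u` with at least `u + 1` elements has at most `u − 2` coloops: if it had
`u` coloops it would be independent, hence of size `u`; if it had `u − 1`, the remaining `≥ 2` elements would
have rank `1`, i.e. form a loop or a parallel pair. -/
theorem card_coloops_le_of_rk_eq (hs : Simple' M) {X : Finset α} (hX : X ⊆ gr M) {u : ℕ} (hu : 2 ≤ u)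
    (hr : rk M X = u) (hc : u + 1 ≤ X.card) : (coloops M X).card ≤ u - 2 := by
  have h := rk_sdiff_coloops_add_card (M := M) hX
  have hKX : coloops M X ⊆ X := coloops_subset X
  have hcard : (X \ coloops M X).card + (coloops M X).card = X.card := card_sdiff_add_card_eq_card hKX
  by_contra hcon
  have hcon' := Nat.lt_of_not_le hcon
  have hle : rk M (X \ coloops M X) ≤ 1 := by omega
  rcases Nat.le_one_iff_eq_zero_or_eq_one.1 hle with h0 | h1
  · have hne : (X \ coloops M X).Nonempty := by
      rw [← card_pos]
      omega
    obtain ⟨x, hx⟩ := hne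
    have hxg : ({x} : Finset α) ⊆ gr M := singleton_subset_iff.2 (hX (sdiff_subset hx))
    have hxi : M.Indep (({x} : Finset α) : Set α) := hs {x} hxg (by simp)
    have hmono := rk_mono' (M := M) (singleton_subset_iff.2 hx)
    rw [rk_eq_card_of_indep hxi, card_singleton] at hmono
    omega
  · have h2 : 1 < (X \ coloops M X).card := by omega
    obtain ⟨x, y, hx, hy, hxy⟩ := one_lt_card_iff.1 h2
    have hsub : ({x, y} : Finset α) ⊆ X \ coloops M X := by
      intro w hw
      rw [mem_insert, mem_singleton] at hw
      rcases hw with rfl | rfl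
      · exact hx
      · exact hy
    have hpair : ({x, y} : Finset α) ⊆ gr M := hsub.trans (sdiff_subset.trans hX)
    have hpi : M.Indep (({x, y} : Finset α) : Set α) := hs {x, y} hpair card_le_two
    have hmono := rk_mono' (M := M) hsub
    rw [rk_eq_card_of_indep hpi, card_pair hxy] at hmono
    omega

/-- `Σ_{z ∈ X} d(ρ(X ∖ z)) = (|X| − κ) · d(ρ X) + κ · d(ρ X − 1)` for `d(r) = [u ≤ r] · C(r, u−2)`,
`κ := #coloops X`. -/
theorem sum_ite_erase {X : Finset α} (hX : X ⊆ gr M) (u : ℕ) :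
    ∑ z ∈ X, (if u ≤ rk M (X.erase z) then (rk M (X.erase z)).choose (u - 2) else 0) =
      (X.card - (coloops M X).card) * (if u ≤ rk M X then (rk M X).choose (u - 2) else 0) +
        (coloops M X).card * (if u ≤ rk M X - 1 then (rk M X - 1).choose (u - 2) else 0) := by
  have hKX : coloops M X ⊆ X := coloops_subset X
  rw [← sum_sdiff hKX]
  congr 1
  · rw [sum_congr rfl (fun z hz => by
        rw [rk_erase_of_notMem_coloops hX (sdiff_subset hz) (mem_sdiff.1 hz).2]),
      sum_const, smul_eq_mul, card_sdiff_of_subset hKX]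
  · rw [sum_congr rfl (fun z hz => by
        have h := rk_erase_of_mem_coloops hX hz
        rw [show rk M (X.erase z) = rk M X - 1 by omega]),
      sum_const, smul_eq_mul]

/-! ### The per-pair inequality -/

/-- The arithmetic core of the per-pair inequality at the levels `ρ ≥ u + 1` (`u = a + 3`, `ρ = r + 1`,
`m = |E| − 2`): `(m − (a+1)) · C(r+1, a+1) ≤ (m − k) · C(r+1, a+1) + k · C(r, a+1)` for `k ≤ r + 1`, by
Pascal and `(r+1) · C(r, a) = (a+1) · C(r+1, a+1)`. -/
theorem perPair_arith_core {a r k m : ℕ} (hkr : k ≤ r + 1) (hkm : k ≤ m) (ham : a + 1 ≤ m) :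
    (m - (a + 1)) * (r + 1).choose (a + 1) ≤ (m - k) * (r + 1).choose (a + 1) + k * r.choose (a + 1) := by
  have hP : (r + 1).choose (a + 1) = r.choose a + r.choose (a + 1) := Nat.choose_succ_succ' r a
  have hS : (r + 1) * r.choose a = (r + 1).choose (a + 1) * (a + 1) := Nat.add_one_mul_choose_eq r a
  have e1 : (m - k) * (r + 1).choose (a + 1) + k * (r + 1).choose (a + 1) = m * (r + 1).choose (a + 1) := by
    rw [← add_mul, Nat.sub_add_cancel hkm]
  have e2 : k * (r + 1).choose (a + 1) = k * r.choose (a + 1) + k * r.choose a := by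
    rw [hP, mul_add, add_comm]
  have e3 : k * r.choose a ≤ (a + 1) * (r + 1).choose (a + 1) := by
    calc k * r.choose a ≤ (r + 1) * r.choose a := Nat.mul_le_mul_right _ hkr
      _ = (r + 1).choose (a + 1) * (a + 1) := hS
      _ = (a + 1) * (r + 1).choose (a + 1) := mul_comm _ _
  have e4 : (m - (a + 1)) * (r + 1).choose (a + 1) + (a + 1) * (r + 1).choose (a + 1) =
      m * (r + 1).choose (a + 1) := by
    rw [← add_mul, Nat.sub_add_cancel ham]
  generalize (m - k) * (r + 1).choose (a + 1) = A at e1 ⊢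
  generalize k * (r + 1).choose (a + 1) = B at e1 e2
  generalize m * (r + 1).choose (a + 1) = C at e1 e4
  generalize k * r.choose (a + 1) = D at e2 ⊢
  generalize k * r.choose a = E at e2 e3
  generalize (a + 1) * (r + 1).choose (a + 1) = F at e3 e4
  generalize (m - (a + 1)) * (r + 1).choose (a + 1) = G at e4 ⊢
  omega

/-- The arithmetic of the per-pair inequality: `(n − u) · d(ρ) ≤ (n − 2 − κ) · d(ρ) + κ · d(ρ − 1)` for
`d(r) = [u ≤ r] · C(r, u−2)`, `κ ≤ ρ`, `κ ≤ u − 2` if `ρ = u`, `u ≥ 3`, `n ≥ u + 3`. -/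
theorem perPair_arith {u n r k : ℕ} (hu : 3 ≤ u) (hn : u + 3 ≤ n) (hkr : k ≤ r)
    (hku : r = u → k ≤ u - 2) (hkn : k ≤ n - 2) :
    (n - u) * (if u ≤ r then r.choose (u - 2) else 0) ≤
      (n - 2 - k) * (if u ≤ r then r.choose (u - 2) else 0) +
        k * (if u ≤ r - 1 then (r - 1).choose (u - 2) else 0) := by
  rcases lt_trichotomy r u with hlt | heq | hgt
  · rw [if_neg (not_le.2 hlt), if_neg (by omega)]
    simp
  · subst heq
    rw [if_pos le_rfl, if_neg (by omega), mul_zero, add_zero]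
    exact Nat.mul_le_mul_right _ (by have := hku rfl; omega)
  · rw [if_pos hgt.le, if_pos (by omega)]
    obtain ⟨a, rfl⟩ : ∃ a, u = a + 3 := ⟨u - 3, by omega⟩
    obtain ⟨r', rfl⟩ : ∃ r', r = r' + 1 := ⟨r - 1, by omega⟩
    rw [show a + 3 - 2 = a + 1 by omega, Nat.add_sub_cancel, show n - (a + 3) = n - 2 - (a + 1) by omega]
    exact perPair_arith_core hkr hkn (by omega)

/-- **The per-pair inequality (PP).**  For a simple matroid `M` on `≥ u + 3` elements, `u ≥ 3`, and an
independent pair `B`: `(|E| − u) · demand_M(B) ≤ Σ_{z ∈ E ∖ B} demand_{M ∖ z}(B)`. -/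
theorem perPair (hs : Simple' M) {u : ℕ} (hu : 3 ≤ u) (hn : u + 3 ≤ (gr M).card) {B : Finset α}
    (hB : B ∈ indepSets M 2) :
    ((gr M).card - u) * demand M 2 u B ≤ ∑ z ∈ gr M \ B, demand (M ＼ ({z} : Set α)) 2 u B := by
  have hX : gr M \ B ⊆ gr M := sdiff_subset
  have hXc : (gr M \ B).card = (gr M).card - 2 := card_sdiff_of_mem_indepSets_two hB
  rw [demand_eq_ite, sum_congr rfl (fun z _ => demand_delete_eq_ite u B z), sum_ite_erase hX u, hXc]
  apply perPair_arith hu hn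
  · exact card_coloops_le_rk hX
  · intro hr
    exact card_coloops_le_of_rk_eq hs hX (by omega) hr (by omega)
  · rw [← hXc]
    exact card_le_card (coloops_subset _)

/-! ### The averaged deletion step and the theorem -/

/-- **The averaged deletion step**: on every simple matroid on `≥ u + 3` elements, `u ≥ 3`,
`(|E| − u) · D₂(M; u) ≤ Σ_{z ∈ E} D₂(M ∖ z; u)`. -/
theorem avg_step (hs : Simple' M) {u : ℕ} (hu : 3 ≤ u) (hn : u + 3 ≤ (gr M).card) :
    ((gr M).card - u) * ∑ B ∈ indepSets M 2, demand M 2 u B ≤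
      ∑ z ∈ gr M, ∑ B ∈ indepSets (M ＼ ({z} : Set α)) 2, demand (M ＼ ({z} : Set α)) 2 u B := by
  rw [mul_sum]
  calc ∑ B ∈ indepSets M 2, ((gr M).card - u) * demand M 2 u B
      ≤ ∑ B ∈ indepSets M 2, ∑ z ∈ gr M \ B, demand (M ＼ ({z} : Set α)) 2 u B :=
        sum_le_sum (fun B hB => perPair hs hu hn hB)
    _ = ∑ z ∈ gr M, ∑ B ∈ (indepSets M 2).filter (fun B => z ∉ B),
          demand (M ＼ ({z} : Set α)) 2 u B := by
        apply sum_comm'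
        intro B z
        rw [mem_sdiff, mem_filter]
        tauto
    _ = ∑ z ∈ gr M, ∑ B ∈ indepSets (M ＼ ({z} : Set α)) 2, demand (M ＼ ({z} : Set α)) 2 u B := by
        apply sum_congr rfl
        intro z _
        rw [indepSets_delete_eq_filter]

/-- **`INDEP_{2,u}` on every simple matroid** — strong induction on `|E|`: the levels `|E| ≤ u + 2` are the
degenerate cases of ProfileTwoDeletion; above them the averaged deletion step and the induction hypothesis on
the simple matroids `M ∖ z` give `(|E| − u) · D₂(M) ≤ Σ_z D₂(M ∖ z) ≤ C(u,2) · Σ_z I_u(M ∖ z) =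
C(u,2) · (|E| − u) · I_u(M)`. -/
theorem indep2_of_simple_aux : ∀ (n : ℕ) (M : Matroid α) [M.Finite], (gr M).card = n → Simple' M →
    ∀ u : ℕ, 3 ≤ u → Indep2 M u := by
  intro n
  induction n using Nat.strong_induction_on with
  | _ n ih =>
    intro M _ hn hs u hu
    rcases Nat.lt_or_ge n (u + 2) with hsmall | hbig
    · exact indep2_of_card_le (by omega) (by omega)
    rcases Nat.eq_or_lt_of_le hbig with heq | hgt
    · exact indep2_of_card_eq (by omega) (by omega)
    have hn3 : u + 3 ≤ (gr M).card := by omega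
    have hstep := avg_step hs hu hn3
    have hih : ∀ z ∈ gr M, ∑ B ∈ indepSets (M ＼ ({z} : Set α)) 2, demand (M ＼ ({z} : Set α)) 2 u B ≤
        u.choose 2 * (indepSets (M ＼ ({z} : Set α)) u).card := by
      intro z hz
      have hcard : (gr (M ＼ ({z} : Set α))).card = n - 1 := by
        rw [gr_delete', card_erase_of_mem hz, hn]
      exact ih (n - 1) (by omega) (M ＼ ({z} : Set α)) hcard (simple'_delete hs z) u hu
    have hsum := sum_le_sum hih
    rw [← mul_sum] at hsum
    have hid := sum_card_indepSets_delete_add (M := M) u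
    have hkey : ((gr M).card - u) * ∑ B ∈ indepSets M 2, demand M 2 u B ≤
        ((gr M).card - u) * (u.choose 2 * (indepSets M u).card) := by
      calc ((gr M).card - u) * ∑ B ∈ indepSets M 2, demand M 2 u B
          ≤ ∑ z ∈ gr M, ∑ B ∈ indepSets (M ＼ ({z} : Set α)) 2, demand (M ＼ ({z} : Set α)) 2 u B :=
            hstep
        _ ≤ u.choose 2 * ∑ z ∈ gr M, (indepSets (M ＼ ({z} : Set α)) u).card := hsum
        _ = u.choose 2 * (((gr M).card - u) * (indepSets M u).card) := by
            rw [Nat.sub_mul, ← hid, Nat.add_sub_cancel]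
        _ = ((gr M).card - u) * (u.choose 2 * (indepSets M u).card) := by ring
    exact Nat.le_of_mul_le_mul_left hkey (by omega)

/-- **`INDEP_{2,u}` on every simple matroid, every `u ≥ 3`** (one-matroid form). -/
theorem indep2_of_simple (hs : Simple' M) {u : ℕ} (hu : 3 ≤ u) : Indep2 M u :=
  indep2_of_simple_aux (gr M).card M rfl hs u hu

/-- The level `u = 2` of `INDEP_2`: every pair has demand at most `1 = C(2,2)`. -/
theorem indep2_two : Indep2 M 2 := by
  unfold Indep2
  rw [Nat.choose_self, one_mul, card_eq_sum_ones]
  apply sum_le_sum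
  intro B _
  unfold demand
  split_ifs
  · rw [Nat.sub_self, Nat.choose_zero_right]
  · exact Nat.zero_le _

end PercRepro.Cogirth
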